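import Mathlib
import Literature.Computability.AlgebraicComplexity.JointCircuits
import Literature.Computability.AlgebraicComplexity.FFTCircuitCost
import Literature.Computability.AlgebraicComplexity.FastSeriesCircuits
import HarnessLib

/-!
# Newton iteration for the inverse of a power series, as a circuit

Topic `Computability/AlgebraicComplexity`, namespace `Literature.Computability.AlgebraicComplexity`.
Everything PROVED; one bookkeeping definition (`invCost`, a gate count), no named facts.

Companion of `FastSeriesCircuits.lean` (product tree; Newton iteration for `P^{-1/2}`): the cost
layer, in the tree's circuit model (`complexity`; `JointlyComputed`, `JointCircuits.lean`; fast
multiplication `jointlyComputed_lconv`, `FFTCircuitCost.lean`), of Newton iteration for the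
INVERSE of a power series over the ring of circuit nodes `k[X_τ]` (von zur Gathen–Gerhard,
*Modern Computer Algebra*, §9.1, Algorithm 9.3 / Thm 9.4: `R ← R(2 − P R)` doubles the precision):

* `coeff_newton_inv` : if `Q P = 1` and `R ≡ Q (mod X^M)` then `2R − P R² ≡ Q (mod X^{2M})`
  (`2R − PR² − Q = −P (R − Q)²`);
* `jointlyComputed_inv_step` / `jointlyComputed_inv` : the first `2^J` coefficients of `Q = P^{-1}`
  (`P` a polynomial of degree `≤ N` over the node ring, `Q(0) = 1`) in
  `invCost J ≤ (12 J + 33) 2^{J+1}` gates — two fast multiplications per doubling.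

Typical consumers (not in this file): complete homogeneous symmetric polynomials
(`∏_l (1 − x_l s)^{-1}`), power sums via the logarithmic derivative `s E'(s)/E(s)`, division with
remainder, all in `O(M(n))` / `O(M(n) log n)` gates on top of the product tree.

## References

* J. von zur Gathen, J. Gerhard, *Modern Computer Algebra*, CUP (3rd ed. 2013), §9.1,
  Algorithm 9.3 and Theorem 9.4 (Newton inversion with fast multiplication). [GathenGerhard2013]
* [Burgisser2000] P. Bürgisser, *Completeness and Reduction in Algebraic Complexity Theory*,
  Springer 2000, Def. 2.1 (the circuit model).
-/

noncomputable section

open MvPolynomial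

namespace Literature.Computability.AlgebraicComplexity

section NewtonInverse

universe uu vv ww

variable {k : Type uu} [CommRing k] {τ : Type vv}

open _root_.Finset _root_.PowerSeries

/-- `lconv` reads its arguments only up to the output index. [folklore] -/
private theorem lconv_congr_le' {S : Type*} [CommSemiring S] {a a' b b' : ℕ → S} {m : ℕ}
    (ha : ∀ i ≤ m, a i = a' i) (hb : ∀ j ≤ m, b j = b' j) : lconv a b m = lconv a' b' m := by
  unfold lconv
  refine sum_congr rfl fun ij hij => ?_
  rw [Finset.HasAntidiagonal.mem_antidiagonal] at hij
  rw [ha ij.1 (by omega), hb ij.2 (by omega)]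

/-- The linear convolution of coefficient sequences of power series is the coefficient sequence
of the product. [folklore] -/
private theorem lconv_coeff_eq_coeff_mul'' {S : Type*} [CommSemiring S] (φ ψ : S⟦X⟧) (m : ℕ) :
    lconv (fun i => coeff i φ) (fun j => coeff j ψ) m = coeff m (φ * ψ) := by
  rw [PowerSeries.coeff_mul]; rfl

/-- **The Newton step for `P^{-1}` doubles the precision** (GG Thm 9.2): if `Q P = 1` and
`R ≡ Q (mod X^M)` then `2R − P R² ≡ Q (mod X^{2M})`, because `2R − PR² − Q = −P(R − Q)²`.
[cite: GathenGerhard2013, §9.1 Thm 9.2] -/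
theorem coeff_newton_inv {S : Type*} [CommRing S] (Q P R : S⟦X⟧) (M : ℕ)
    (hQ : Q * P = 1) (hR : ∀ j < M, coeff j R = coeff j Q) {m : ℕ} (hm : m < 2 * M) :
    coeff m (2 * R - P * R ^ 2) = coeff m Q := by
  have hδ : (PowerSeries.X : S⟦X⟧) ^ M ∣ R - Q := by
    rw [PowerSeries.X_pow_dvd_iff]
    intro j hj
    rw [map_sub, hR j hj, sub_self]
  obtain ⟨E, hE⟩ := hδ
  have key : 2 * R - P * R ^ 2 - Q = -(P * (R - Q) ^ 2) := by
    linear_combination (Q - 2 * R) * hQ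
  have hdiv : (PowerSeries.X : S⟦X⟧) ^ (2 * M) ∣ 2 * R - P * R ^ 2 - Q := by
    rw [key, hE, show P * (PowerSeries.X ^ M * E) ^ 2 =
      PowerSeries.X ^ (2 * M) * (P * E ^ 2) by ring]
    exact (dvd_mul_right _ _).neg_right
  have h0 := (PowerSeries.X_pow_dvd_iff.mp hdiv) m hm
  rwa [map_sub, sub_eq_zero] at h0

/-- **One Newton step for `P^{-1}` as a circuit** (GG Algorithm 9.3 with fast multiplication, cost
part; Bürgisser's model): if the coefficients of `P` (a polynomial of degree `≤ N` over the node
ring, as a power series) and the first `2^i` coefficients of `Q = P^{-1}` (`Q P = 1`) are read off a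
jointly computed family within `s` gates, then so are the first `2^{i+1}` coefficients of `Q` within
`s + (12 i + 33) · 2^{i+1}` gates: two fast multiplications (`jointlyComputed_lconv`, transform
length `2^{i+2}`) and `2^{i+1}` weighted additions `2 r_m − w_m` (`coeff_newton_inv`).
[cite: GathenGerhard2013, §9.1 Thm 9.4] -/
theorem jointlyComputed_inv_step (ζ tinv : ℕ → k)
    (hζ : ∀ κ, κ ≠ 0 → ζ κ ^ 2 ^ (κ - 1) = -1) (ht : ∀ κ, (2 ^ κ : k) * tinv κ = 1)
    {ι : Type ww} {v : ι → MvPolynomial τ k} {s : ℕ} (hv : JointlyComputed v s)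
    (Q P : (MvPolynomial τ k)⟦X⟧) (hQ : Q * P = 1) (N : ℕ)
    (hP : ∀ j, N < j → coeff j P = 0) (eP : Fin (N + 1) → ι) (heP : ∀ j, v (eP j) = coeff j P)
    (i : ℕ) (er : Fin (2 ^ i) → ι) (her : ∀ j, v (er j) = coeff j Q) :
    JointlyComputed (Sum.elim v (fun m : Fin (2 ^ (i + 1)) => coeff m Q))
      (s + (12 * i + 33) * 2 ^ (i + 1)) := by
  classical
  have h2M : 2 ^ (i + 1) = 2 * 2 ^ i := by rw [pow_succ, mul_comm]
  have h4M : 2 ^ (i + 2) = 4 * 2 ^ i := by rw [pow_add]; ring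
  -- the truncation `R` of `Q` and its coefficient sequence `r`
  let r : ℕ → MvPolynomial τ k := fun m => if m < 2 ^ i then coeff m Q else 0
  let R : (MvPolynomial τ k)⟦X⟧ := PowerSeries.mk r
  have hRc : ∀ m, coeff m R = r m := fun m => PowerSeries.coeff_mk _ _
  have hR : ∀ j < 2 ^ i, coeff j R = coeff j Q := fun j hj => by rw [hRc]; exact if_pos hj
  have hr0 : ∀ m, 2 ^ i ≤ m → r m = 0 := fun m hm => if_neg (not_lt.2 hm)
  have her' : ∀ j : Fin (2 ^ i), v (er j) = r j := fun j => by
    rw [her]; exact (if_pos j.isLt).symm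
  -- step 1: `u = P' ∗ r` with `P'` the truncation of `P` below `2^{i+1}` (transform length `2^{i+2}`)
  let P' : ℕ → MvPolynomial τ k := fun j => if j < 2 ^ (i + 1) then coeff j P else 0
  let w₁ : ι ⊕ Fin (2 ^ (i + 1)) → MvPolynomial τ k := Sum.elim v (fun j => P' j)
  have hw₁ : JointlyComputed w₁ s := by
    refine hv.of_mem _ ?_
    rintro (x | j)
    · exact Or.inl ⟨x, rfl⟩
    · by_cases hj : (j : ℕ) ≤ N
      · refine Or.inl ⟨eP ⟨j, by omega⟩, ?_⟩
        simp [w₁, P', heP]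
      · refine Or.inr (Or.inr ⟨0, ?_⟩)
        simp [w₁, P', hP j (by omega)]
  have h1 := jointlyComputed_lconv hw₁ (κ := i + 2) (Nat.succ_ne_zero _)
    (hζ _ (Nat.succ_ne_zero _)) (ht _) P' r (la := 2 ^ (i + 1)) (lb := 2 ^ i)
    (fun j hj => if_neg (by omega)) hr0 (by rw [h4M, h2M]; omega)
    (fun j => Sum.inr j) (fun j => Sum.inl (er j)) (fun j => rfl)
    (fun j => by simp [w₁, her'])
  set u : ℕ → MvPolynomial τ k := lconv P' r with hu
  have hu' : ∀ m < 2 ^ (i + 1), u m = coeff m (P * R) := by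
    intro m hm
    rw [hu, ← lconv_coeff_eq_coeff_mul'']
    exact lconv_congr_le' (fun j hj => if_pos (by omega)) (fun j _ => (hRc j).symm)
  -- step 2: `w = r ∗ u'` (transform length `2^{i+2}`)
  let u' : ℕ → MvPolynomial τ k := fun j => if j < 2 ^ (i + 1) then u j else 0
  have h2 := jointlyComputed_lconv h1 (κ := i + 2) (Nat.succ_ne_zero _)
    (hζ _ (Nat.succ_ne_zero _)) (ht _) r u' (la := 2 ^ i) (lb := 2 ^ (i + 1)) hr0
    (fun j hj => if_neg (by omega)) (by rw [h4M, h2M]; omega)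
    (fun j => Sum.inl (Sum.inl (er j)))
    (fun j => Sum.inr ⟨j, by have h1 : (j : ℕ) < 2 ^ (i + 1) := j.isLt; omega⟩)
    (fun j => by simp [w₁, her'])
    (fun j => by simp [u', j.isLt])
  set w : ℕ → MvPolynomial τ k := lconv r u' with hw
  have hw' : ∀ m < 2 ^ (i + 1), w m = coeff m (R * (P * R)) := by
    intro m hm
    rw [hw, ← lconv_coeff_eq_coeff_mul'']
    exact lconv_congr_le' (fun j _ => (hRc j).symm)
      (fun j hj => by simp only [u']; rw [if_pos (by omega), hu' j (by omega)])
  -- step 3: the weighted additions `2 r_m − w_m`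
  let w₂ : (((ι ⊕ Fin (2 ^ (i + 1))) ⊕ Fin (2 ^ (i + 2))) ⊕ Fin (2 ^ (i + 2))) ⊕
      (Fin (2 ^ (i + 1)) ⊕ Fin (2 ^ (i + 1))) → MvPolynomial τ k :=
    Sum.elim (Sum.elim (Sum.elim w₁ (fun m : Fin (2 ^ (i + 2)) => u m))
      (fun m : Fin (2 ^ (i + 2)) => w m))
      (Sum.elim (fun m : Fin (2 ^ (i + 1)) => r m) (fun m : Fin (2 ^ (i + 1)) => w m))
  have hw₂ : JointlyComputed w₂ (s + (3 * (i + 2) + 2) * 2 ^ (i + 2) +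
      (3 * (i + 2) + 2) * 2 ^ (i + 2)) := by
    refine h2.of_mem _ ?_
    rintro (x | (m | m))
    · exact Or.inl ⟨x, rfl⟩
    · by_cases hm : (m : ℕ) < 2 ^ i
      · refine Or.inl ⟨Sum.inl (Sum.inl (Sum.inl (er ⟨m, hm⟩))), ?_⟩
        simp [w₂, w₁, her']
      · exact Or.inr (Or.inr ⟨0, by simp [w₂, r, hm]⟩)
    · refine Or.inl ⟨Sum.inr ⟨m, by have h1 : (m : ℕ) < 2 ^ (i + 1) := m.isLt; omega⟩, ?_⟩
      simp [w₂]
  have h3 := hw₂.extend_wadd (κ := Fin (2 ^ (i + 1))) (fun _ => (2 : k)) (fun _ => (-1 : k))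
    (fun m => Sum.inr (Sum.inl m)) (fun m => Sum.inr (Sum.inr m))
  rw [Fintype.card_fin] at h3
  have hcost : s + (3 * (i + 2) + 2) * 2 ^ (i + 2) + (3 * (i + 2) + 2) * 2 ^ (i + 2) +
      2 ^ (i + 1) = s + (12 * i + 33) * 2 ^ (i + 1) := by
    rw [h4M, h2M]; ring
  rw [hcost] at h3
  refine h3.of_mem _ ?_
  rintro (x | m)
  · exact Or.inl ⟨Sum.inl (Sum.inl (Sum.inl (Sum.inl (Sum.inl x)))), rfl⟩
  · have hm : (m : ℕ) < 2 ^ (i + 1) := m.isLt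
    refine Or.inl ⟨Sum.inr m, ?_⟩
    simp only [Sum.elim_inr, w₂, Sum.elim_inl]
    rw [hw' m hm, ← hRc m, MvPolynomial.smul_eq_C_mul, MvPolynomial.smul_eq_C_mul]
    have key := coeff_newton_inv Q P R (2 ^ i) hQ hR (m := m) (by omega)
    rw [show P * R ^ 2 = R * (P * R) by ring, map_sub] at key
    have h2R : (coeff m) (2 * R) = 2 * coeff m R := by
      rw [show (2 : (MvPolynomial τ k)⟦X⟧) * R = R + R by ring, map_add]; ring
    rw [h2R] at key
    rw [← key, MvPolynomial.C_neg, MvPolynomial.C_1,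
      show (MvPolynomial.C (2 : k) : MvPolynomial τ k) = 2 from map_ofNat _ _]
    ring

/-- Gate count of `J` Newton steps for `P^{-1}` from precision `1` to `2^J`.
[cite: GathenGerhard2013, §9.1 Thm 9.4] -/
def invCost : ℕ → ℕ
  | 0 => 0
  | J + 1 => invCost J + (12 * J + 33) * 2 ^ (J + 1)

/-- `invCost J ≤ (12 J + 33) 2^{J+1}` (geometric sum). [cite: GathenGerhard2013, §9.1 Thm 9.4] -/
theorem invCost_le (J : ℕ) : invCost J ≤ (12 * J + 33) * 2 ^ (J + 1) := by
  induction J with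
  | zero => simp [invCost]
  | succ J ih =>
    rw [invCost, show (12 * (J + 1) + 33) * 2 ^ (J + 1 + 1) =
      2 * ((12 * J + 33) * 2 ^ (J + 1)) + 24 * 2 ^ (J + 1) by ring]
    omega

/-- **Newton inversion as a circuit** (GG Algorithm 9.3 / Thm 9.4, cost with fast
multiplication): the first `2^J` coefficients of `Q = P^{-1}` (`Q P = 1`, `Q(0) = 1`, `P` a
polynomial of degree `≤ N` over the node ring whose coefficients are read off the family) are
jointly computed within `invCost J ≤ (12 J + 33) 2^{J+1}` further gates.
[cite: GathenGerhard2013, §9.1 Thm 9.4] -/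
theorem jointlyComputed_inv (ζ tinv : ℕ → k)
    (hζ : ∀ κ, κ ≠ 0 → ζ κ ^ 2 ^ (κ - 1) = -1) (ht : ∀ κ, (2 ^ κ : k) * tinv κ = 1)
    (Q P : (MvPolynomial τ k)⟦X⟧) (hQ : Q * P = 1) (hQ0 : coeff 0 Q = 1) (N : ℕ)
    (hP : ∀ j, N < j → coeff j P = 0) :
    ∀ (J : ℕ) {ι : Type ww} (v : ι → MvPolynomial τ k) (s : ℕ) (eP : Fin (N + 1) → ι),
      JointlyComputed v s → (∀ j, v (eP j) = coeff j P) →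
      JointlyComputed (Sum.elim v (fun m : Fin (2 ^ J) => coeff m Q)) (s + invCost J)
  | 0, ι, v, s, eP, hv, heP => by
    rw [invCost, Nat.add_zero]
    refine hv.of_mem _ ?_
    rintro (x | m)
    · exact Or.inl ⟨x, rfl⟩
    · refine Or.inr (Or.inr ⟨1, ?_⟩)
      simp [hQ0]
  | J + 1, ι, v, s, eP, hv, heP => by
    have ih := jointlyComputed_inv ζ tinv hζ ht Q P hQ hQ0 N hP J v s eP hv heP
    have hstep := jointlyComputed_inv_step ζ tinv hζ ht ih Q P hQ N hP
      (fun j => Sum.inl (eP j)) (fun j => by simp [heP]) J (fun j => Sum.inr j) (fun j => rfl)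
    rw [invCost, ← Nat.add_assoc]
    refine hstep.of_mem _ ?_
    rintro (x | m)
    · exact Or.inl ⟨Sum.inl (Sum.inl x), rfl⟩
    · exact Or.inl ⟨Sum.inr m, rfl⟩

end NewtonInverse

end Literature.Computability.AlgebraicComplexity

end
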